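import Literature.MathematicalPhysics.QuantumFieldTheory.Balaban1983to89.B4Lemma22RegField
import Literature.MathematicalPhysics.QuantumFieldTheory.Balaban1983to89.B4Lemma22RegFieldDual
import Literature.MathematicalPhysics.QuantumFieldTheory.Balaban1983to89.B4Lemma22RegularCubeFam

/-!
# [B4] LEMMA 2.2 IN b04's TYPED FORM `B4.Lemma22Printed fam (d + 1)` — BOTH CONJUNCTS VERBATIM — INHABITED ON THE
# FAMILY OF ALL (1.7)-REGULAR CONFIGURATIONS `Ã` ON BOXES THAT ARE CONSTANT ON THE BOUNDARY COLLAR (the printed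
# hypothesis «Ã a regular vector field configuration …, constant in a neighbourhood of the boundary of □»)
# [Balaban1983RegularityDecay]

statement-level skeleton of published theorems with citation tags; proofs where landed; nothing here is a claim about the Yang–Mills mass gap

CITATION HEADER.  T. Bałaban, *Regularity and decay of lattice Green's functions*, Commun. Math. Phys. **89** (1983)
571–597, doi:10.1007/bf01214744 [Balaban1983RegularityDecay] (cell paper B4; held text
`paper:balaban1983-cmp89-regularity-decay`, journal page = PDF page + 570; pp. 573, 575, 577–579, 581, 583; Lemma 2.2
and (2.14) read from the page renders `…regularity-decay-p007-x2.png`, `…-p008-x2.png`).  PDF held: yes.  Unit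
`lit-balaban-p35` gen 7 (Phase-2 proof seat), HOME `run/shared/lean/pub/lit-balaban/`.  WHAT IS REPRODUCED: SKELETON row
**B4.Lem2.2** — the row's decl `B4.Lemma22Printed` (b04, `B4.lean`) INHABITED at `A ≠ 0` on the family of ALL fields
satisfying the printed hypotheses in the lineage's reading (kind «model-instance»; file 4 of 4 of the general-field
Lemma 2.2).  Companions: gen 7's `B4Lemma22RegularCubeFam.lemma22Printed_cubeFieldFam` (the sub-family of the cube
configurations `Ã_j` of p. 575, whose carrier functionals `lpN`, `weight_le_of_neg` are reused here BY NAME) and the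
zero-field leaf `B4Lemma22ZeroBoxLpLq.lemma22Printed_cubeFam`.  Imports `B4Lemma22RegField`, `B4Lemma22RegFieldDual`
(the members at a general regular `Ã`), `B4Lemma22RegularCubeFam`.

WHAT IS PRINTED (pp. 577–578, verbatim from the renders).  «(2.14) ‖f‖_{1,α} = max{sup_x |f(x)|, sup_{x,μ}
|(D^η_{A,μ}f)(x)|, sup_{x,x′,μ} (1/|x′ − x|^α)|U(A(Γ_{x,x′}))·(D^η_{A,μ}f)(x′) − (D^η_{A,μ}f)(x)|}, where the suprema
are taken on a domain of the function f. … Lemma 2.2. Let a rectangular parallelepiped □ be a sum of few large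
blocks (e.g., as in the case of the cubes □_j), and let Ã be a regular vector field configuration in the sense of
Proposition I.2.1, constant in a neighbourhood of the boundary of □. Then for e sufficiently small and α < 1, there
exists a constant c₁ depending on d, α only, such that ‖G_k(□,Ã)f‖_{1,α} ≤ c₁‖f‖_∞, (2.16) and a constant c₂
depending on d, p₁, such that ‖G_k(□,Ã)f‖_q, ‖D^η_{Ã,μ}G_k(□,Ã)f‖_q, ‖G_k(□,Ã)D^{η*}_{Ã,μ}f‖_q ≤ c₂‖f‖_p (2.17) for
1 ≤ p, q ≤ ∞, satisfying the condition 1/p − 1/p₁ ≤ 1/q ≤ 1/p with p₁ > d.»  p. 579 (2.23): «A = A₀ + A′, |A′|,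
|∂^η_μA′| ≤ c′e^{β−1}»; p. 573 (1.7): «|(∂^η_μA)(x)| ≤ ce^{β−1}», «for e sufficiently small».

THE MODEL INSTANCE (HONEST SCOPE).  Fixed family data: the lattice dimension `d + 1` (the print's `d`), `L = ℓ + 1 ≥ 2`,
the orthogonal flow `F` of (1.2) with its Lipschitz constant, the windows `a ∈ [a₋, a₊]` (`a₋ > 0`), `m² ∈ [0, m²₊]`,
the regularity constants `(c, β)` of (1.7) and the side bound `S`.  An index `i : RegFieldInst` is: a scale `k ≥ 1`
(`n = L^k`), `a`, `m²` in the windows, a box `□ = Π_μ[0, nM_μ)` (`M_μ ≥ 1` unit blocks), a component field `Ã` on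
`ℤ^{d+1}`, a charge `e`.  Its `CubeSetting` (`regFieldFam … i`): sources `f : □ × colours → ℝ`; the field is the bond
function of `Ã` on `□` at coupling `e/n`, `G_k(□,Ã)` = the lineage's `greenA` with the staircase block contours,
`D^η_{Ã,μ}` = `derivA`, `D^{η*}` its transpose; the typed antecedents READ: `rect = True` (every member is a rectangular
parallelepiped), `fewLargeBlocks` = «□ a sum of few large blocks»: `M_μ ≤ S`, `regular` = «Ã regular in the sense of
Proposition I.2.1» = (1.7) for `Ã` on `□` with `(c, β)`, every pair of directions, `constNearBdry` = «constant in a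
neighbourhood of the boundary of □» = `Ã(x) = Ã(0)` componentwise at every site of `□` with a coordinate `x_μ = 0` or
`x_μ ≥ nM_μ − 2` (`B4RegFieldHyps22`; the cube configurations `Ã_j` of p. 575 satisfy it: `collar_cubeComp`).  Norms as
in `B4Lemma22RegularCubeFam`: `‖f‖_∞ = supN`, `‖f‖_p = lpW` (`η^{d+1}`-weighted, `lpN` indexed by `s = 1/p`), the Hölder
norm (2.14) `hold` with the supremum over `μ`, sites `x ≠ x′` whose forward `μ`-bonds lie in `□` and EVERY
nearest-neighbour chain `Γ` from `x` to `x′` with `|Γ| ≤ (d+1)|x′ − x|_∞`, weight `|x′ − x|_η^{−α}` (sup-distance).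
* **`lemma22Printed_regFieldFam`** — `B4.Lemma22Printed (regFieldFam F d ℓ a₋ a₊ m²₊ c β S) (d + 1)`: conjunct 1
  ((2.16), every `α < 1`: `lemma22_16_regFieldFam`), conjunct 2 ((2.17), every `(1/p, 1/q)` of the parallelogram, all
  three members: `lemma22_17_regFieldFam`), `c₁`/`c₂` and `e₁` uniform over the family.
* `antecedents_met_reg` — non-vacuity at every threshold `e₁ > 0`.
NOT certified: non-abelian link groups beyond the lineage's one-parameter orthogonal flows; regions other than boxes;
the typed statement at a dimension parameter `≤ d`; `A₀ = Ã(0)` makes `e₁` depend on `S` («c′ = dMc»); the constants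
depend on `(N, flow, L, a₋, a₊, m²₊)` besides `(d, α)` / `(d, p₁)`, as in every node of this lineage.  No `Prop` fact,
no `sorry`; axioms standard.
-/

namespace Literature.MathematicalPhysics.QuantumFieldTheory.Balaban1983to89.B4Lemma22RegFieldFam

open Finset Matrix
open Literature.MathematicalPhysics.QuantumFieldTheory.Balaban1983to89.B4 (CubeSetting Lemma22Printed)
open Literature.MathematicalPhysics.QuantumFieldTheory.Balaban1983to89.B4GaugeCovariance
open Literature.MathematicalPhysics.QuantumFieldTheory.Balaban1983to89.B4Reflection242 (boxDom nbrs mem_boxDom)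
open Literature.MathematicalPhysics.QuantumFieldTheory.Balaban1983to89.B4Lower18Regular (e1 baseEmb stairContour)
open Literature.MathematicalPhysics.QuantumFieldTheory.Balaban1983to89.B4Lower18RegularRegion (compField)
open Literature.MathematicalPhysics.QuantumFieldTheory.Balaban1983to89.B4Lemma21Region (siteNorm)
open Literature.MathematicalPhysics.QuantumFieldTheory.Balaban1983to89.B4ContourShift (supNorm supNorm_nonneg)
open Literature.MathematicalPhysics.QuantumFieldTheory.Balaban1983to89.B4Lemma22Reduce231 (supN supN_nonneg le_supN
  siteNorm_nonneg)
open Literature.MathematicalPhysics.QuantumFieldTheory.Balaban1983to89.B4Lemma22ReduceZero (Box greenA derivA)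
open Literature.MathematicalPhysics.QuantumFieldTheory.Balaban1983to89.B4Lemma22EtaBox (lpW lpW_nonneg)
open Literature.MathematicalPhysics.QuantumFieldTheory.Balaban1983to89.B4Lemma22HolderBox (IsNNChain siteNorm_sub_le)
open Literature.MathematicalPhysics.QuantumFieldTheory.Balaban1983to89.B4HolderChainTools (siteNorm_transport_mulVec)
open Literature.MathematicalPhysics.QuantumFieldTheory.Balaban1983to89.B4CubeFields22 (cubeComp cubeComp_apply
  thetaZ_eq_zero_of_face)
open Literature.MathematicalPhysics.QuantumFieldTheory.Balaban1983to89.B4Lemma22RegField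
open Literature.MathematicalPhysics.QuantumFieldTheory.Balaban1983to89.B4Lemma22RegFieldDual (lemma22_dual_regField
  lemma22_dual_one_regField lemma22_dual_sup_regField lemma22_holder_regField)
open Literature.MathematicalPhysics.QuantumFieldTheory.Balaban1983to89.B4Lemma22RegularCubeFam (lpN lpN_zero lpN_of_ne
  lpN_nonneg weight_le_of_neg)

noncomputable section

variable {ι : Type} [Fintype ι] [DecidableEq ι]

/-! ## §1. The index of the family and its operators -/

/-- AN INDEX OF THE GENERAL REGULAR-FIELD FAMILY (family data `d, ℓ`, windows `[a₋,a₊]`, `[0,m²₊]` fixed): the scale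
`k ≥ 1` (`n = L^k`), the coefficient `a` and the mass `m²` in their windows, the box `Π_μ[0, nM_μ)` (`M_μ ≥ 1`), the
component field `Ã` and the charge `e`. [cite: Balaban1983RegularityDecay, Lemma 2.2 pp. 577–578, dictionary] -/
structure RegFieldInst (d ℓ : ℕ) (amin aplus m2plus : ℝ) where
  /-- the scale: `η = L^{-k}` -/
  k : ℕ
  hk : 1 ≤ k
  /-- the coefficient of `aP_k` and the mass -/
  a : ℝ
  ha : amin ≤ a
  ha' : a ≤ aplus
  m2 : ℝ
  hm : 0 ≤ m2
  hm' : m2 ≤ m2plus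
  /-- the box `Π_μ[0, nM_μ)` -/
  M : Fin (d + 1) → ℕ
  hM : ∀ i, 1 ≤ M i
  /-- the component field `Ã`, the charge -/
  Ac : (Fin (d + 1) → ℤ) → Fin (d + 1) → ℝ
  e : ℝ

namespace RegFieldInst

variable {d ℓ : ℕ} {amin aplus m2plus : ℝ} (i : RegFieldInst d ℓ amin aplus m2plus)

/-- `n = L^k ≥ 1` (the mesh `η = L^{−k}`; private twin of `B4Lemma22RegularCubeFam.RegInst.hn`). [folklore] -/
private theorem hn : 1 ≤ (ℓ + 1) ^ i.k := Nat.one_le_pow _ _ (Nat.succ_pos ℓ)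

/-- the bond function of the member's field `Ã` on `□` («A_{⟨x,x+ηe_μ⟩} = A_μ(x)»).
[cite: Balaban1983RegularityDecay, (1.2) p. 572] -/
def fieldA : ↥(Box d ℓ i.k i.M) → ↥(Box d ℓ i.k i.M) → ℝ := fun u v => compField i.Ac u.1 v.1

/-- `G_k(□, Ã)` (1.6) at coupling `e/n`, staircase block contours. [cite: Balaban1983RegularityDecay, (1.6) p. 572] -/
def G (F : OrthFlow ι) : Matrix (↥(Box d ℓ i.k i.M) × ι) (↥(Box d ℓ i.k i.M) × ι) ℝ :=
  greenA d F (i.e / ((ℓ + 1) ^ i.k : ℕ)) ℓ i.k i.a i.m2 i.M (baseEmb i.hn i.M) (stairContour i.hn i.M) i.fieldA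

/-- `D^η_{Ã,μ}` (1.3) at coupling `e/n`. [cite: Balaban1983RegularityDecay, (1.3) p. 572] -/
def D (F : OrthFlow ι) (μ : Fin (d + 1)) : Matrix (↥(Box d ℓ i.k i.M) × ι) (↥(Box d ℓ i.k i.M) × ι) ℝ :=
  derivA d F (i.e / ((ℓ + 1) ^ i.k : ℕ)) ℓ i.k i.M i.fieldA μ

/-- the three vectors of (2.17): `G f`, `D_μ G f`, `G D_μ^* f` (`D^* = Dᵀ`). [cite: Balaban1983RegularityDecay, (2.17) p. 578, dictionary] -/
def opY (F : OrthFlow ι) (m : Fin 3) (μ : Fin (d + 1)) (f : ↥(Box d ℓ i.k i.M) × ι → ℝ) :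
    ↥(Box d ℓ i.k i.M) × ι → ℝ :=
  if m = 0 then i.G F *ᵥ f else if m = 1 then i.D F μ *ᵥ (i.G F *ᵥ f) else (i.G F * (i.D F μ)ᵀ) *ᵥ f

/-- the four vectors of (2.15): `G f`, `D_μ G f`, `G D_μ^* f`, `D_μ G D_ν^* f`. [cite: Balaban1983RegularityDecay, (2.15) p. 577, dictionary] -/
def opX (F : OrthFlow ι) (m : Fin 4) (μ ν : Fin (d + 1)) (f : ↥(Box d ℓ i.k i.M) × ι → ℝ) :
    ↥(Box d ℓ i.k i.M) × ι → ℝ :=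
  if m = 0 then i.G F *ᵥ f else if m = 1 then i.D F μ *ᵥ (i.G F *ᵥ f)
  else if m = 2 then (i.G F * (i.D F μ)ᵀ) *ᵥ f else i.D F μ *ᵥ ((i.G F * (i.D F ν)ᵀ) *ᵥ f)

/-- the Hölder norm (2.14) of `u` at the field `Ã`: `max{‖u‖_∞, sup_μ ‖D^η_{Ã,μ}u‖_∞, sup |x′−x|_η^{−α}
|U(Ã(Γ))(D^η_{Ã,μ}u)(x′) − (D^η_{Ã,μ}u)(x)|}`, the last supremum over `μ`, sites `x ≠ x′` whose forward `μ`-bonds lie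
in `□`, and all nearest-neighbour chains `Γ` from `x` to `x′` with `|Γ| ≤ (d+1)|x′ − x|_∞`.
[cite: Balaban1983RegularityDecay, (2.14) p. 577] -/
def hold (F : OrthFlow ι) (α : ℝ) (u : ↥(Box d ℓ i.k i.M) × ι → ℝ) : ℝ :=
  max (supN u) (max (⨆ μ : Fin (d + 1), supN (i.D F μ *ᵥ u))
    (⨆ (μ : Fin (d + 1)) (x : ↥(Box d ℓ i.k i.M)) (xe : ↥(Box d ℓ i.k i.M)) (x' : ↥(Box d ℓ i.k i.M))
      (xe' : ↥(Box d ℓ i.k i.M)) (l : List ↥(Box d ℓ i.k i.M))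
      (_ : xe.1 = x.1 + e1 μ ∧ xe'.1 = x'.1 + e1 μ ∧ x'.1 ≠ x.1 ∧ IsNNChain x l ∧ pathEnd x l = x' ∧
        (l.length : ℝ) ≤ ((d : ℝ) + 1) * supNorm (x'.1 - x.1)),
      ((((ℓ + 1) ^ i.k : ℕ) : ℝ) / supNorm (x'.1 - x.1)) ^ α *
        siteNorm (transport (fieldLink F (i.e / ((ℓ + 1) ^ i.k : ℕ)) i.fieldA) x l *ᵥ fld (i.D F μ *ᵥ u) x'
          - fld (i.D F μ *ᵥ u) x)))

end RegFieldInst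

/-! ## §2. The family of cube settings -/

/-- **THE GENERAL REGULAR-FIELD FAMILY**: the fields of b04's `B4.CubeSetting` filled with their meanings at a
(1.7)-regular field `Ã` on a box that is constant on the boundary collar (see the module docstring for the reading of
each field). [cite: Balaban1983RegularityDecay, Lemma 2.2 (2.14)–(2.17) pp. 577–578 with (2.23) p. 579 and (1.7) p. 573] -/
def regFieldFam (F : OrthFlow ι) (d ℓ : ℕ) (amin aplus m2plus creg β : ℝ) (S : ℕ)
    (i : RegFieldInst d ℓ amin aplus m2plus) : CubeSetting where
  Src := ↥(Box d ℓ i.k i.M) × ι → ℝ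
  Dir := Fin (d + 1)
  e := i.e
  fewLargeBlocks := ∀ μ, i.M μ ≤ S
  rect := True
  regular := ∀ x ∈ Box d ℓ i.k i.M, ∀ μ ν : Fin (d + 1),
    |i.Ac (x + e1 μ) ν - i.Ac x ν| ≤ creg * i.e ^ (β - 1) / ((ℓ + 1) ^ i.k : ℕ)
  constNearBdry := ∀ x ∈ Box d ℓ i.k i.M, ∀ μ : Fin (d + 1),
    (x μ = 0 ∨ (((ℓ + 1) ^ i.k * i.M μ : ℕ) : ℤ) ≤ x μ + 2) → ∀ ν, i.Ac x ν = i.Ac 0 ν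
  l2Norm := fun f => lpW d ℓ i.k 2 f
  supNorm := fun f => supN f
  lpNorm := fun s f => lpN d ℓ i.k s f
  opL2 := fun m μ ν f => lpW d ℓ i.k 2 (i.opX F m μ ν f)
  holder1 := fun α f => i.hold F α (i.G F *ᵥ f)
  opLq := fun m μ t f => lpN d ℓ i.k t (i.opY F m μ f)

section Readings

variable (F : OrthFlow ι) {d ℓ : ℕ} {amin aplus m2plus : ℝ} (creg β : ℝ) (S : ℕ)
  (i : RegFieldInst d ℓ amin aplus m2plus)

/-- the typed «few large blocks» antecedent of a member reads `M_μ ≤ S`. [cite: Balaban1983RegularityDecay, Lemma 2.2 p. 577 «a sum of few large blocks», dictionary] -/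
theorem fewLargeBlocks_iff : (regFieldFam F d ℓ amin aplus m2plus creg β S i).fewLargeBlocks ↔ ∀ μ, i.M μ ≤ S :=
  Iff.rfl

/-- the typed «regular» antecedent of a member reads: (1.7) for `Ã` on `□` with the constants `(c, β)`.
[cite: Balaban1983RegularityDecay, Lemma 2.2 p. 577 «a regular vector field configuration» with (1.7) p. 573, dictionary] -/
theorem regular_iff : (regFieldFam F d ℓ amin aplus m2plus creg β S i).regular ↔
    ∀ x ∈ Box d ℓ i.k i.M, ∀ μ ν : Fin (d + 1),
      |i.Ac (x + e1 μ) ν - i.Ac x ν| ≤ creg * i.e ^ (β - 1) / ((ℓ + 1) ^ i.k : ℕ) :=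
  Iff.rfl

/-- the typed «constant near the boundary» antecedent of a member reads: `Ã = Ã(0)` on the two-layer collar of `∂□`.
[cite: Balaban1983RegularityDecay, Lemma 2.2 p. 577 «constant in a neighbourhood of the boundary of □», dictionary] -/
theorem constNearBdry_iff : (regFieldFam F d ℓ amin aplus m2plus creg β S i).constNearBdry ↔
    ∀ x ∈ Box d ℓ i.k i.M, ∀ μ : Fin (d + 1),
      (x μ = 0 ∨ (((ℓ + 1) ^ i.k * i.M μ : ℕ) : ℤ) ≤ x μ + 2) → ∀ ν, i.Ac x ν = i.Ac 0 ν :=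
  Iff.rfl

/-- every member is a rectangular parallelepiped. [cite: Balaban1983RegularityDecay, Lemma 2.2 p. 577 «a rectangular parallelepiped □», dictionary] -/
theorem rect_holds : (regFieldFam F d ℓ amin aplus m2plus creg β S i).rect := trivial

omit [Fintype ι] [DecidableEq ι] in
/-- **THE CUBE CONFIGURATIONS `Ã_j` OF p. 575 ARE CONSTANT ON THE COLLAR** (so, in component form `cubeComp`, they belong to
this family's «constant near the boundary» reading): in the box `Π_μ[0, nM_μ)` containing the cube of the label `j`
(`K(j_μ + 1) ≤ M_μ`, `j_μ ≥ 1`, `nK ≥ 16`), `Ã_j(x) = A(0) = Ã_j(0)` componentwise at every collar site.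
[cite: Balaban1983RegularityDecay, §2 p. 575 «changing regularly to a constant function in a neighbourhood of a boundary of □_j»] -/
theorem collar_cubeComp {n K : ℕ} (hn : 1 ≤ n) (hK : 1 ≤ K) (hnK : 16 ≤ n * K) {M : Fin (d + 1) → ℕ}
    {j : Fin (d + 1) → ℤ} (hjlo : ∀ μ, 1 ≤ j μ) (hjhi : ∀ μ, (K : ℤ) * (j μ + 1) ≤ M μ)
    (Ac : (Fin (d + 1) → ℤ) → Fin (d + 1) → ℝ) {x : Fin (d + 1) → ℤ} {μ : Fin (d + 1)}
    (hx : x μ = 0 ∨ ((n * M μ : ℕ) : ℤ) ≤ x μ + 2) (ν : Fin (d + 1)) :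
    cubeComp n K j (Ac 0) Ac x ν = cubeComp n K j (Ac 0) Ac 0 ν := by
  have hjhi' : ∀ μ, (n : ℤ) * K * (j μ + 1) ≤ ((n * M μ : ℕ) : ℤ) := fun μ => by
    push_cast; rw [mul_assoc]; exact mul_le_mul_of_nonneg_left (hjhi μ) (by positivity)
  have h0 : B4CubeFields22.thetaZ n K j x = 0 := thetaZ_eq_zero_of_face hn hK hnK hjlo hjhi' (μ := μ) hx
  rw [cubeComp_apply, cubeComp_apply, h0, zero_mul, add_zero, sub_self, mul_zero, add_zero]

end Readings

/-! ## §3. (2.16) and (2.17) on the family; the typed statement -/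

section Main

/-- `x ≤ cB`, `c ≤ C`, `B ≥ 0` give `x ≤ CB`. [folklore] -/
private theorem le_mul_of_le_mul {x B c C : ℝ} (h : x ≤ c * B) (hc : c ≤ C) (hB : 0 ≤ B) : x ≤ C * B :=
  h.trans (mul_le_mul_of_nonneg_right hc hB)

variable (F : OrthFlow ι) {ℓ₁ : ℝ} (hℓ₁ : 0 ≤ ℓ₁)
  (hLip : ∀ t (v : ι → ℝ), ((F.U t - 1) *ᵥ v) ⬝ᵥ ((F.U t - 1) *ᵥ v) ≤ (ℓ₁ * t) ^ 2 * (v ⬝ᵥ v))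
  (d ℓ : ℕ) (hℓ : 1 ≤ ℓ) (amin aplus m2plus : ℝ) (ha : 0 < amin) (creg β : ℝ) (hcreg : 0 ≤ creg) (hβ : 0 < β)
  (S : ℕ)

include hℓ₁ hLip hℓ ha hcreg hβ

/-- **(2.16) FOR EVERY `α < 1` ON THE GENERAL REGULAR-FIELD FAMILY** — `‖G_k(□,Ã)f‖_{1,α} ≤ c₁‖f‖_∞` with ONE `c₁` and
ONE threshold `e₁` for the whole family: the three entries of (2.14) from `B4Lemma22RegField.lemma22_sup_regField`
(`sup|Gf|`, `sup|D_μGf|`) and `B4Lemma22RegFieldDual.lemma22_holder_regField` (the quotient, `0 ≤ α < 1`); for `α < 0`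
the quotient is `≤ S^{|α|}·2 sup|D_μGf|` (`B4Lemma22RegularCubeFam.weight_le_of_neg`, orthogonality of `U(Ã(Γ))`).
[cite: Balaban1983RegularityDecay, Lemma 2.2 (2.16) p. 578 with (2.14) p. 577, (2.23) p. 579, (1.7) p. 573] -/
theorem lemma22_16_regFieldFam (α : ℝ) (hα : α < 1) :
    ∃ c₁ e₁ : ℝ, 0 < c₁ ∧ 0 < e₁ ∧ ∀ i : RegFieldInst d ℓ amin aplus m2plus,
      (regFieldFam F d ℓ amin aplus m2plus creg β S i).rect →
      (regFieldFam F d ℓ amin aplus m2plus creg β S i).fewLargeBlocks →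
      (regFieldFam F d ℓ amin aplus m2plus creg β S i).regular →
      (regFieldFam F d ℓ amin aplus m2plus creg β S i).constNearBdry →
      0 < (regFieldFam F d ℓ amin aplus m2plus creg β S i).e →
      (regFieldFam F d ℓ amin aplus m2plus creg β S i).e ≤ e₁ →
      ∀ f : (regFieldFam F d ℓ amin aplus m2plus creg β S i).Src,
        (regFieldFam F d ℓ amin aplus m2plus creg β S i).holder1 α f
          ≤ c₁ * (regFieldFam F d ℓ amin aplus m2plus creg β S i).supNorm f := by
  obtain ⟨C₁, hC₁, h₁⟩ := lemma22_sup_regField F hℓ₁ hLip d ℓ hℓ amin aplus m2plus ha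
  obtain ⟨e₁, he₁, g₁⟩ := h₁ creg β hcreg hβ S
  by_cases hα0 : 0 ≤ α
  · obtain ⟨C₂, hC₂, h₂⟩ := lemma22_holder_regField F hℓ₁ hLip d ℓ hℓ amin aplus m2plus ha α hα0 hα
    obtain ⟨e₂, he₂, g₂⟩ := h₂ creg β hcreg hβ S
    refine ⟨C₁ + C₂, min e₁ e₂, by positivity, lt_min he₁ he₂, ?_⟩
    intro i _ hS h17 hcol he hle f
    have he' : 0 < i.e := he
    have hB : 0 ≤ (C₁ + C₂) * supN f := by have := supN_nonneg f; positivity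
    obtain ⟨k0, k1⟩ := g₁ i.k i.hk i.hn i.a i.m2 i.ha i.ha' i.hm i.hm' i.M i.hM hS i.Ac i.e he'
      (hle.trans (min_le_left _ _)) h17 hcol f
    have kH := g₂ i.k i.hk i.hn i.a i.m2 i.ha i.ha' i.hm i.hm' i.M i.hM hS i.Ac i.e he'
      (hle.trans (min_le_right _ _)) h17 hcol
    show i.hold F α (i.G F *ᵥ f) ≤ (C₁ + C₂) * supN f
    unfold RegFieldInst.hold RegFieldInst.G RegFieldInst.D RegFieldInst.fieldA
    refine max_le (le_mul_of_le_mul k0 (by linarith) (supN_nonneg f)) (max_le ?_ ?_)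
    · exact Real.iSup_le (fun μ => le_mul_of_le_mul (k1 μ) (by linarith) (supN_nonneg f)) hB
    · refine Real.iSup_le (fun μ => Real.iSup_le (fun x => Real.iSup_le (fun xe => Real.iSup_le (fun x' =>
        Real.iSup_le (fun xe' => Real.iSup_le (fun l => Real.iSup_le (fun h => ?_) hB) hB) hB) hB) hB) hB) hB
      obtain ⟨hxe, hxe', hne, hl, hlend, hlen⟩ := h
      exact le_mul_of_le_mul (kH μ x xe x' xe' hxe hxe' hne l hl hlend hlen f) (by linarith) (supN_nonneg f)
  · rw [not_le] at hα0
    refine ⟨C₁ + (S : ℝ) ^ (-α) * (2 * C₁), e₁, by positivity, he₁, ?_⟩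
    intro i _ hS h17 hcol he hle f
    have he' : 0 < i.e := he
    have hSα : 0 ≤ (S : ℝ) ^ (-α) := Real.rpow_nonneg (by positivity) _
    have hB : 0 ≤ (C₁ + (S : ℝ) ^ (-α) * (2 * C₁)) * supN f := by have := supN_nonneg f; positivity
    obtain ⟨k0, k1⟩ := g₁ i.k i.hk i.hn i.a i.m2 i.ha i.ha' i.hm i.hm' i.M i.hM hS i.Ac i.e he' hle h17 hcol f
    have hCle : C₁ ≤ C₁ + (S : ℝ) ^ (-α) * (2 * C₁) := by nlinarith
    show i.hold F α (i.G F *ᵥ f) ≤ (C₁ + (S : ℝ) ^ (-α) * (2 * C₁)) * supN f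
    unfold RegFieldInst.hold RegFieldInst.G RegFieldInst.D RegFieldInst.fieldA
    refine max_le (le_mul_of_le_mul k0 hCle (supN_nonneg f)) (max_le ?_ ?_)
    · exact Real.iSup_le (fun μ => le_mul_of_le_mul (k1 μ) hCle (supN_nonneg f)) hB
    · refine Real.iSup_le (fun μ => Real.iSup_le (fun x => Real.iSup_le (fun xe => Real.iSup_le (fun x' =>
        Real.iSup_le (fun xe' => Real.iSup_le (fun l => Real.iSup_le (fun h => ?_) hB) hB) hB) hB) hB) hB) hB
      set v := derivA d F (i.e / ((ℓ + 1) ^ i.k : ℕ)) ℓ i.k i.M (fun u v => compField i.Ac u.1 v.1) μ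
        *ᵥ (greenA d F (i.e / ((ℓ + 1) ^ i.k : ℕ)) ℓ i.k i.a i.m2 i.M (baseEmb i.hn i.M) (stairContour i.hn i.M)
          (fun u v => compField i.Ac u.1 v.1) *ᵥ f) with hv
      have hw := weight_le_of_neg (d := d) i.hn hS x.2 x'.2 hα0
      have hdiff : siteNorm (transport (fieldLink F (i.e / ((ℓ + 1) ^ i.k : ℕ))
            (fun u v : ↥(Box d ℓ i.k i.M) => compField i.Ac u.1 v.1)) x l *ᵥ fld v x' - fld v x)
          ≤ 2 * C₁ * supN f := by
        refine (siteNorm_sub_le _ _).trans ?_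
        rw [siteNorm_transport_mulVec]
        have h1 := le_supN v x'
        have h2 := le_supN v x
        have h3 := k1 μ
        linarith
      have hw0 : 0 ≤ ((((ℓ + 1) ^ i.k : ℕ) : ℝ) / supNorm (x'.1 - x.1)) ^ α :=
        Real.rpow_nonneg (div_nonneg (by positivity) (supNorm_nonneg _)) _
      calc ((((ℓ + 1) ^ i.k : ℕ) : ℝ) / supNorm (x'.1 - x.1)) ^ α
            * siteNorm (transport (fieldLink F (i.e / ((ℓ + 1) ^ i.k : ℕ))
                (fun u v : ↥(Box d ℓ i.k i.M) => compField i.Ac u.1 v.1)) x l *ᵥ fld v x' - fld v x)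
          ≤ (S : ℝ) ^ (-α) * (2 * C₁ * supN f) :=
            mul_le_mul hw hdiff (siteNorm_nonneg _) hSα
        _ ≤ (C₁ + (S : ℝ) ^ (-α) * (2 * C₁)) * supN f := by
            have := supN_nonneg f; nlinarith

/-- **(2.17) ON THE GENERAL REGULAR-FIELD FAMILY, EVERY PAIR OF THE PRINTED PARALLELOGRAM, ALL THREE MEMBERS** — for
`p₁ > d + 1` ONE `c₂` and ONE threshold `e₁` with `‖Yf‖_q ≤ c₂‖f‖_p` for `Y ∈ {G_k(□,Ã), D^η_{Ã,μ}G_k(□,Ã),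
G_k(□,Ã)D^{η*}_{Ã,μ}}` and all `0 ≤ t ≤ s ≤ 1`, `s − 1/p₁ ≤ t` (`s = 1/p`, `t = 1/q`), assembled from
`B4Lemma22RegField` (`lemma22_sup_regField`, `lemma22_weighted_regField`, `lemma22_psup_regField`,
`lemma22_dual_corners_regField`) and `B4Lemma22RegFieldDual` (`lemma22_dual_regField`, `lemma22_dual_one_regField`,
`lemma22_dual_sup_regField`). [cite: Balaban1983RegularityDecay, Lemma 2.2 (2.17) p. 578 with p. 583, (2.23) p. 579, (1.7) p. 573] -/
theorem lemma22_17_regFieldFam {p₁ : ℝ} (hp₁ : (d : ℝ) + 1 < p₁) :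
    ∃ c₂ e₁ : ℝ, 0 < c₂ ∧ 0 < e₁ ∧ ∀ i : RegFieldInst d ℓ amin aplus m2plus,
      (regFieldFam F d ℓ amin aplus m2plus creg β S i).rect →
      (regFieldFam F d ℓ amin aplus m2plus creg β S i).fewLargeBlocks →
      (regFieldFam F d ℓ amin aplus m2plus creg β S i).regular →
      (regFieldFam F d ℓ amin aplus m2plus creg β S i).constNearBdry →
      0 < (regFieldFam F d ℓ amin aplus m2plus creg β S i).e →
      (regFieldFam F d ℓ amin aplus m2plus creg β S i).e ≤ e₁ →
      ∀ (s t : ℝ) (n : Fin 3) (μ : (regFieldFam F d ℓ amin aplus m2plus creg β S i).Dir)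
        (f : (regFieldFam F d ℓ amin aplus m2plus creg β S i).Src),
        0 ≤ t → s ≤ 1 → s - 1 / p₁ ≤ t → t ≤ s →
        (regFieldFam F d ℓ amin aplus m2plus creg β S i).opLq n μ t f
          ≤ c₂ * (regFieldFam F d ℓ amin aplus m2plus creg β S i).lpNorm s f := by
  have hp₁0 : 0 < p₁ := lt_trans (by positivity) hp₁
  obtain ⟨C₁, hC₁, h₁⟩ := lemma22_sup_regField F hℓ₁ hLip d ℓ hℓ amin aplus m2plus ha
  obtain ⟨C₂, hC₂, h₂⟩ := lemma22_weighted_regField F hℓ₁ hLip d ℓ hℓ amin aplus m2plus ha hp₁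
  obtain ⟨C₃, hC₃, h₃⟩ := lemma22_psup_regField F hℓ₁ hLip d ℓ hℓ amin aplus m2plus ha hp₁
  obtain ⟨C₄, hC₄, h₄⟩ := lemma22_dual_regField F hℓ₁ hLip d ℓ hℓ amin aplus m2plus ha hp₁
  obtain ⟨C₅, hC₅, h₅⟩ := lemma22_dual_one_regField F hℓ₁ hLip d ℓ hℓ amin aplus m2plus ha hp₁
  obtain ⟨C₆, hC₆, h₆⟩ := lemma22_dual_sup_regField F hℓ₁ hLip d ℓ hℓ amin aplus m2plus ha hp₁
  obtain ⟨C₇, hC₇, h₇⟩ := lemma22_dual_corners_regField F hℓ₁ hLip d ℓ hℓ amin aplus m2plus ha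
  obtain ⟨e₁, he₁, g₁⟩ := h₁ creg β hcreg hβ S
  obtain ⟨e₂, he₂, g₂⟩ := h₂ creg β hcreg hβ S
  obtain ⟨e₃, he₃, g₃⟩ := h₃ creg β hcreg hβ S
  obtain ⟨e₄, he₄, g₄⟩ := h₄ creg β hcreg hβ S
  obtain ⟨e₅, he₅, g₅⟩ := h₅ creg β hcreg hβ S
  obtain ⟨e₆, he₆, g₆⟩ := h₆ creg β hcreg hβ S
  obtain ⟨e₇, he₇, g₇⟩ := h₇ creg β hcreg hβ S
  set C : ℝ := C₁ + C₂ + C₃ + C₄ + C₅ + C₆ + C₇ with hC_def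
  set e₀ : ℝ := min (min (min e₁ e₂) (min e₃ e₄)) (min (min e₅ e₆) e₇) with he₀_def
  have he₀ : 0 < e₀ := lt_min (lt_min (lt_min he₁ he₂) (lt_min he₃ he₄)) (lt_min (lt_min he₅ he₆) he₇)
  refine ⟨C, e₀, by positivity, he₀, ?_⟩
  intro i _ hS h17 hcol he hle s t n μ f ht0 hs1 hst hts
  have he' : 0 < i.e := he
  have hl₁ : i.e ≤ e₁ := hle.trans ((min_le_left _ _).trans ((min_le_left _ _).trans (min_le_left _ _)))
  have hl₂ : i.e ≤ e₂ := hle.trans ((min_le_left _ _).trans ((min_le_left _ _).trans (min_le_right _ _)))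
  have hl₃ : i.e ≤ e₃ := hle.trans ((min_le_left _ _).trans ((min_le_right _ _).trans (min_le_left _ _)))
  have hl₄ : i.e ≤ e₄ := hle.trans ((min_le_left _ _).trans ((min_le_right _ _).trans (min_le_right _ _)))
  have hl₅ : i.e ≤ e₅ := hle.trans ((min_le_right _ _).trans ((min_le_left _ _).trans (min_le_left _ _)))
  have hl₆ : i.e ≤ e₆ := hle.trans ((min_le_right _ _).trans ((min_le_left _ _).trans (min_le_right _ _)))
  have hl₇ : i.e ≤ e₇ := hle.trans ((min_le_right _ _).trans (min_le_right _ _))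
  have c₁le : C₁ ≤ C := by rw [hC_def]; linarith
  have c₂le : C₂ ≤ C := by rw [hC_def]; linarith
  have c₃le : C₃ ≤ C := by rw [hC_def]; linarith
  have c₄le : C₄ ≤ C := by rw [hC_def]; linarith
  have c₅le : C₅ ≤ C := by rw [hC_def]; linarith
  have c₆le : C₆ ≤ C := by rw [hC_def]; linarith
  have c₇le : C₇ ≤ C := by rw [hC_def]; linarith
  have hst' : s - t ≤ p₁⁻¹ := by rw [← one_div]; linarith
  show lpN d ℓ i.k t (i.opY F n μ f) ≤ C * lpN d ℓ i.k s f
  unfold RegFieldInst.opY RegFieldInst.G RegFieldInst.D RegFieldInst.fieldA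
  by_cases ht : t = 0
  · subst ht
    rw [lpN_zero]
    by_cases hs : s = 0
    · -- the corner `q = p = ∞`
      subst hs
      rw [lpN_zero]
      obtain ⟨k0, k1⟩ := g₁ i.k i.hk i.hn i.a i.m2 i.ha i.ha' i.hm i.hm' i.M i.hM hS i.Ac i.e he' hl₁ h17 hcol f
      by_cases hn0 : n = 0
      · rw [if_pos hn0]; exact le_mul_of_le_mul k0 c₁le (supN_nonneg f)
      rw [if_neg hn0]
      by_cases hn1 : n = 1
      · rw [if_pos hn1]; exact le_mul_of_le_mul (k1 μ) c₁le (supN_nonneg f)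
      rw [if_neg hn1]
      exact le_mul_of_le_mul (g₇ i.k i.hk i.hn i.a i.m2 i.ha i.ha' i.hm i.hm' i.M i.hM hS i.Ac i.e he' hl₇ h17
        hcol f μ).2 c₇le (supN_nonneg f)
    · -- the edge `q = ∞`, `p₁ ≤ p = 1/s < ∞`
      have hs0 : 0 < s := lt_of_le_of_ne hts (Ne.symm hs)
      have hp : p₁ ≤ s⁻¹ := by
        rw [← inv_le_inv₀ (inv_pos.2 hs0) hp₁0, inv_inv]; linarith
      rw [lpN_of_ne _ _ _ hs]
      obtain ⟨k0, k1⟩ := g₃ i.k i.hk i.hn i.a i.m2 i.ha i.ha' i.hm i.hm' i.M i.hM hS i.Ac i.e he' hl₃ h17 hcol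
        s⁻¹ hp f
      by_cases hn0 : n = 0
      · rw [if_pos hn0]; exact le_mul_of_le_mul k0 c₃le (lpW_nonneg _ _ _ _ f)
      rw [if_neg hn0]
      by_cases hn1 : n = 1
      · rw [if_pos hn1]; exact le_mul_of_le_mul (k1 μ) c₃le (lpW_nonneg _ _ _ _ f)
      rw [if_neg hn1]
      exact le_mul_of_le_mul (g₆ i.k i.hk i.hn i.a i.m2 i.ha i.ha' i.hm i.hm' i.M i.hM hS i.Ac i.e he' hl₆ h17
        hcol s⁻¹ hp f μ) c₆le (lpW_nonneg _ _ _ _ f)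
  · -- `q = 1/t < ∞`
    have ht0' : 0 < t := lt_of_le_of_ne ht0 (Ne.symm ht)
    have hs0 : 0 < s := lt_of_lt_of_le ht0' hts
    rw [lpN_of_ne _ _ _ ht, lpN_of_ne _ _ _ hs0.ne']
    have hp1 : 1 ≤ s⁻¹ := (one_le_inv₀ hs0).2 hs1
    have hpq : s⁻¹ ≤ t⁻¹ := inv_anti₀ ht0' hts
    have hσ : s⁻¹⁻¹ - t⁻¹⁻¹ ≤ p₁⁻¹ := by rw [inv_inv, inv_inv]; exact hst'
    obtain ⟨k0, k1⟩ := g₂ i.k i.hk i.hn i.a i.m2 i.ha i.ha' i.hm i.hm' i.M i.hM hS i.Ac i.e he' hl₂ h17 hcol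
      s⁻¹ t⁻¹ hp1 hpq hσ f
    by_cases hn0 : n = 0
    · rw [if_pos hn0]; exact le_mul_of_le_mul k0 c₂le (lpW_nonneg _ _ _ _ f)
    rw [if_neg hn0]
    by_cases hn1 : n = 1
    · rw [if_pos hn1]; exact le_mul_of_le_mul (k1 μ) c₂le (lpW_nonneg _ _ _ _ f)
    rw [if_neg hn1]
    by_cases hs1' : s = 1
    · subst hs1'
      rw [inv_one]
      by_cases ht1 : t = 1
      · -- the corner `q = p = 1`
        subst ht1
        rw [inv_one]
        exact le_mul_of_le_mul (g₇ i.k i.hk i.hn i.a i.m2 i.ha i.ha' i.hm i.hm' i.M i.hM hS i.Ac i.e he' hl₇ h17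
          hcol f μ).1 c₇le (lpW_nonneg _ _ _ _ f)
      · -- the edge `p = 1 < q`
        have ht1' : t < 1 := lt_of_le_of_ne hts ht1
        have hq1 : 1 < t⁻¹ := (one_lt_inv₀ ht0').2 ht1'
        have hqσ : 1 - t⁻¹⁻¹ ≤ p₁⁻¹ := by rw [inv_inv]; exact hst'
        exact le_mul_of_le_mul (g₅ i.k i.hk i.hn i.a i.m2 i.ha i.ha' i.hm i.hm' i.M i.hM hS i.Ac i.e he' hl₅
          h17 hcol t⁻¹ hq1 hqσ f μ) c₅le (lpW_nonneg _ _ _ _ f)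
    · -- `1 < p ≤ q < ∞`
      have hs1'' : s < 1 := lt_of_le_of_ne hs1 hs1'
      have hp1' : 1 < s⁻¹ := (one_lt_inv₀ hs0).2 hs1''
      exact le_mul_of_le_mul (g₄ i.k i.hk i.hn i.a i.m2 i.ha i.ha' i.hm i.hm' i.M i.hM hS i.Ac i.e he' hl₄ h17
        hcol s⁻¹ t⁻¹ hp1' hpq hσ f μ) c₄le (lpW_nonneg _ _ _ _ f)

/-- **b04's TYPED LEMMA 2.2 — `B4.Lemma22Printed fam (d + 1)`, BOTH CONJUNCTS VERBATIM — INHABITED ON THE FAMILY OF ALL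
(1.7)-REGULAR FIELDS ON BOXES CONSTANT ON THE BOUNDARY COLLAR** (the dimension parameter `d + 1` = the lattice dimension
of the family, the print's `d`): conjunct 1 is `lemma22_16_regFieldFam`, conjunct 2 is `lemma22_17_regFieldFam`.  Row
B4.Lem2.2 at `A ≠ 0` (model instance: every `Ã` meeting the printed hypotheses in the lineage's reading; super-family
of `B4Lemma22RegularCubeFam.lemma22Printed_cubeFieldFam`'s cube configurations, `collar_cubeComp`).
[cite: Balaban1983RegularityDecay, Lemma 2.2 (2.16)–(2.17) pp. 577–578] -/
theorem lemma22Printed_regFieldFam :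
    Lemma22Printed (regFieldFam F d ℓ amin aplus m2plus creg β S) (d + 1) := by
  constructor
  · intro α hα
    exact lemma22_16_regFieldFam F hℓ₁ hLip d ℓ hℓ amin aplus m2plus ha creg β hcreg hβ S α hα
  · intro p₁ hp₁
    have hp₁' : (d : ℝ) + 1 < p₁ := by exact_mod_cast hp₁
    exact lemma22_17_regFieldFam F hℓ₁ hLip d ℓ hℓ amin aplus m2plus ha creg β hcreg hβ S hp₁'

omit hℓ₁ hLip hℓ ha hβ in
/-- NON-VACUITY: for every threshold `e₁ > 0` (and a non-empty `a`-window, `m²₊ ≥ 0`, `S ≥ 1`) some member of the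
family meets ALL typed antecedents with `0 < e ≤ e₁` — e.g. the unit box at scale `k = 1` with the constant field
`Ã = 0` —, so the uniformity certified by `lemma22Printed_regFieldFam` is exercised.
[cite: Balaban1983RegularityDecay, Lemma 2.2 pp. 577–578 «for e sufficiently small», dictionary] -/
theorem antecedents_met_reg (hap : amin ≤ aplus) (hm2 : 0 ≤ m2plus) (hS1 : 1 ≤ S) {e₁ : ℝ} (he₁ : 0 < e₁) :
    ∃ i : RegFieldInst d ℓ amin aplus m2plus,
      (regFieldFam F d ℓ amin aplus m2plus creg β S i).rect ∧
      (regFieldFam F d ℓ amin aplus m2plus creg β S i).fewLargeBlocks ∧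
      (regFieldFam F d ℓ amin aplus m2plus creg β S i).regular ∧
      (regFieldFam F d ℓ amin aplus m2plus creg β S i).constNearBdry ∧
      0 < (regFieldFam F d ℓ amin aplus m2plus creg β S i).e ∧
      (regFieldFam F d ℓ amin aplus m2plus creg β S i).e ≤ e₁ := by
  refine ⟨⟨1, le_rfl, amin, le_rfl, hap, 0, le_rfl, hm2, fun _ => 1, fun _ => le_rfl, fun _ _ => 0, e₁⟩, trivial,
    fun _ => hS1, ?_, fun _ _ _ _ _ => rfl, he₁, le_rfl⟩
  intro x _ μ ν
  simp only [sub_self, abs_zero]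
  positivity

end Main

/-! ## §4. The cube configurations `Ã_j` of p. 575 are members of the general family -/

section CubeMembers

open Literature.MathematicalPhysics.QuantumFieldTheory.Balaban1983to89.B4Lemma22RegularCubeFam (RegInst cubeFieldFam)
open Literature.MathematicalPhysics.QuantumFieldTheory.Balaban1983to89.B4PartitionUnity22 (thetaProf D1 D1_nonneg
  contDiff_thetaProf hasCompactSupport_thetaProf)
open Literature.MathematicalPhysics.QuantumFieldTheory.Balaban1983to89.B4CubeFields22 (cubeComp_regular)

variable {d ℓ : ℕ} {amin aplus m2plus : ℝ} {K : ℕ}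

/-- the member of the general family carried by a member of gen 7's cube-configuration family: same scale, windows, box
and charge, the field being the component form `cubeComp` of `Ã_j = A₀ + θ_jA′`.
[cite: Balaban1983RegularityDecay, §2 p. 575 «Ã_j = A₀ + θ_jA′», dictionary] -/
def toRegField (i : RegInst d ℓ amin aplus m2plus K) : RegFieldInst d ℓ amin aplus m2plus :=
  ⟨i.k, i.hk, i.a, i.ha, i.ha', i.m2, i.hm, i.hm', i.M, i.hM, cubeComp ((ℓ + 1) ^ i.k) K i.j (i.Ac 0) i.Ac, i.e⟩

/-- a box site whose forward `μ`-neighbour leaves the box sits on the high face: `N_μ ≤ x_μ + 1`. [folklore] -/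
private theorem coord_ge_of_add_not_mem {N : Fin (d + 1) → ℕ} {x : Fin (d + 1) → ℤ} (hx : x ∈ boxDom N)
    {μ : Fin (d + 1)} (h : x + e1 μ ∉ boxDom N) : (N μ : ℤ) ≤ x μ + 1 := by
  by_contra hne
  apply h
  rw [mem_boxDom] at hx ⊢
  intro i
  by_cases hi : i = μ
  · subst hi
    simp only [Pi.add_apply, B4Lower18Regular.e1_apply_self]
    have := hx i
    omega
  · simp only [Pi.add_apply, B4Lower18Regular.e1_apply_ne hi, add_zero]
    exact hx i

/-- **THE CUBE CONFIGURATIONS BELONG TO THE GENERAL FAMILY**: if a member of the cube-configuration family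
(`B4Lemma22RegularCubeFam.cubeFieldFam`, constants `(c, β)`, side bound `S`, cube size `K ≥ 1`) meets its typed
antecedents «few large blocks», «regular», «constant near the boundary» and has `e > 0`, then the member `toRegField i`
of the general family with the regularity constant `c(1 + D1(θ)(d+1)S/K)` («Of course it satisfies the regularity
condition (1.4) with another constant c») meets the same three antecedents — (1.7) for `Ã_j` by gen 6's
`B4CubeFields22.cubeComp_regular`, the collar constancy by `collar_cubeComp`.
[cite: Balaban1983RegularityDecay, §2 p. 575, Lemma 2.2 p. 577] -/
theorem antecedents_toRegField (F : OrthFlow ι) (creg β : ℝ) (S : ℕ) (hK1 : 1 ≤ K)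
    (i : RegInst d ℓ amin aplus m2plus K) (hcreg : 0 ≤ creg) (he : 0 < i.e)
    (hS : (cubeFieldFam F d ℓ amin aplus m2plus creg β S K i).fewLargeBlocks)
    (hreg : (cubeFieldFam F d ℓ amin aplus m2plus creg β S K i).regular)
    (hcnb : (cubeFieldFam F d ℓ amin aplus m2plus creg β S K i).constNearBdry) :
    (regFieldFam F d ℓ amin aplus m2plus (creg * (1 + D1 thetaProf * (((d : ℝ) + 1) * S) / K)) β S
        (toRegField i)).fewLargeBlocks ∧
    (regFieldFam F d ℓ amin aplus m2plus (creg * (1 + D1 thetaProf * (((d : ℝ) + 1) * S) / K)) β S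
        (toRegField i)).regular ∧
    (regFieldFam F d ℓ amin aplus m2plus (creg * (1 + D1 thetaProf * (((d : ℝ) + 1) * S) / K)) β S
        (toRegField i)).constNearBdry := by
  obtain ⟨hjlo, hjhi⟩ := hcnb
  have hSf : ∀ μ, i.M μ ≤ S := hS
  have hn := i.hn
  have hnr : (0 : ℝ) < ((ℓ + 1) ^ i.k : ℕ) := by exact_mod_cast hn
  have hKr : (0 : ℝ) < K := by exact_mod_cast hK1
  have hD : 0 ≤ D1 thetaProf := D1_nonneg contDiff_thetaProf hasCompactSupport_thetaProf
  have hN : ∀ ν, 1 ≤ (ℓ + 1) ^ i.k * i.M ν := fun ν => le_trans hn (Nat.le_mul_of_pos_right _ (i.hM ν))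
  have hT : ∀ ν, (((ℓ + 1) ^ i.k * i.M ν : ℕ) : ℤ) ≤ (((ℓ + 1) ^ i.k : ℕ) : ℤ) * S := fun ν => by
    push_cast; exact mul_le_mul_of_nonneg_left (by exact_mod_cast hSf ν) (by positivity)
  have hjhi' : ∀ ν, (((ℓ + 1) ^ i.k : ℕ) : ℤ) * K * (i.j ν + 1) ≤ (((ℓ + 1) ^ i.k * i.M ν : ℕ) : ℤ) := fun ν => by
    push_cast; rw [mul_assoc]; exact mul_le_mul_of_nonneg_left (hjhi ν) (by positivity)
  have hδ : 0 ≤ creg * i.e ^ (β - 1) / ((ℓ + 1) ^ i.k : ℕ) := by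
    have := (Real.rpow_pos_of_pos he (β - 1)).le; positivity
  refine ⟨hSf, ?_, ?_⟩
  · intro x hx μ ν
    have hx' : x ∈ Box d ℓ i.k i.M := hx
    show |cubeComp ((ℓ + 1) ^ i.k) K i.j (i.Ac 0) i.Ac (x + e1 μ) ν - cubeComp ((ℓ + 1) ^ i.k) K i.j (i.Ac 0) i.Ac x ν|
      ≤ creg * (1 + D1 thetaProf * (((d : ℝ) + 1) * S) / K) * i.e ^ (β - 1) / ((ℓ + 1) ^ i.k : ℕ)
    by_cases hxμ : x + e1 μ ∈ Box d ℓ i.k i.M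
    · have h := cubeComp_regular hN hT hδ hreg hn hK1 i.j hx' hxμ ν
      calc _ ≤ _ := h
        _ = _ := by push_cast; field_simp
    · -- both end points lie on the collar, where `θ_j = 0`
      have hge : (((ℓ + 1) ^ i.k * i.M μ : ℕ) : ℤ) ≤ x μ + 1 := coord_ge_of_add_not_mem hx' hxμ
      have h1 : B4CubeFields22.thetaZ ((ℓ + 1) ^ i.k) K i.j x = 0 :=
        thetaZ_eq_zero_of_face hn hK1 i.hnK hjlo hjhi' (μ := μ) (Or.inr (by omega))
      have h2 : B4CubeFields22.thetaZ ((ℓ + 1) ^ i.k) K i.j (x + e1 μ) = 0 :=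
        thetaZ_eq_zero_of_face hn hK1 i.hnK hjlo hjhi' (μ := μ)
          (Or.inr (by simp only [Pi.add_apply, B4Lower18Regular.e1_apply_self]; omega))
      rw [cubeComp_apply, cubeComp_apply, h1, h2, zero_mul, zero_mul, add_zero, sub_self, abs_zero]
      have := (Real.rpow_pos_of_pos he (β - 1)).le
      positivity
  · intro x _ μ hxμ ν
    exact collar_cubeComp hn hK1 i.hnK hjlo hjhi i.Ac hxμ ν

end CubeMembers

end

end Literature.MathematicalPhysics.QuantumFieldTheory.Balaban1983to89.B4Lemma22RegFieldFam
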